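import Mathlib.Tactic.Ring
import Mathlib.Tactic.Linarith
import Mathlib.Algebra.Order.Chebyshev
import Mathlib.Algebra.BigOperators.Ring.Finset
import Mathlib.Algebra.Order.BigOperators.Group.Finset
import Mathlib.GroupTheory.SpecificGroups.Dihedral
import Mathlib.GroupTheory.SpecificGroups.Quaternion
import Mathlib.Data.ZMod.Basic
import Summits.MatrixMultiplication.OmegaCensus.K4BoundInjections

/-!
# K4 bound, part 2: `[G : Z(G)] = 4 ⇒ 4·|S||T||U| ≤ 5·|G|` for every TPP triple; `D8 × A`, `Q8 × A`; cell AG-184-3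

ω-census, family (b3) (single TPP triples in small groups); tpp lane (sr-tpp-search-g16, restyled g19).
Framing: lottery ticket; floor = certified bounds/negative ranges.

**Theorem (`K4_bound`).** Let `z ∈ G` be a central involution with `G' ⊆ {1, z}` and such that every
factorisation `a b c = z` has a central factor or `[a, b] = z` (hypotheses of `K4BoundInjections.lean`; they hold
whenever `[G : Z(G)] = 4`).  Then every triple `(S, T, U)` with the triple product property satisfies
`4 |S| |T| |U| ≤ 5 |G|`.  Hence (`not_realizesTPP`) `¬ RealizesTPP G a b c` whenever `5|G| < 4abc`; the hypotheses
transfer from `Q` to `Q × A` for abelian `A` (`K4Hyp.prod`) and hold for `D8 = DihedralGroup 4` and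
`Q8 = QuaternionGroup 2` (`decide`), so **`β(D8 × A), β(Q8 × A) ≤ (5/4)·|G|`** for every finite abelian `A`; in
particular the frontier cell AG-184-3 of the census (the K4 groups `D8 × C23`, `Q8 × C23` of order 184, `Σ dᵢ³ = 276`)
has no TPP triple of sizes `(9, 8, 4)` (`4·288 = 1152 > 920 = 5·184`): `D8xC23_no_tpp_9_8_4`, `Q8xC23_no_tpp_9_8_4`.

**Proof (counting).** With `P = S × T × U` and the collisions `Ω = {(p, q) ∈ P² : w(p, q) = z}`:
(B) `2|Ω| ≤ 3|P|` — every collision has a central coordinate quotient (`central_quotient`), so lies in two of the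
three families `C12, C13, C23`, each of which injects into `P` (`inj12/13/23`); (C) the pairs `(p, q)` with
`s't'u' ∈ {stu, stu·z}` are diagonal or collisions (`M_word`), so number `≤ |P| + |Ω|`; (D) with
`b(g) = #{p : g ∈ {stu, stu z}}`, `Σ b = 2|P|` and `Σ b² ≤ 2·#Rel`; Cauchy–Schwarz over `G` gives
`4|P|² ≤ |G| Σ b² ≤ 2|G|(|P| + |Ω|) ≤ 2|G|·(5/2)|P|`, i.e. `4|P| ≤ 5|G|`.
Informal write-up: HOME/sr-tpp-search-g16/K4-THEORY.md (tpp lane).  New mathematics of the cell (elementary; not a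
published statement): it lives under `Summits/`, not `Literature/`.
-/

open Finset
open Literature.Combinatorics.Additive
open Literature.Computability.AlgebraicComplexity

namespace Summit.MatrixMultiplication.OmegaCensus.K4Bound

variable {G : Type*} [Group G]

/-! ### Counting -/

section Count
variable [Fintype G] [DecidableEq G] {z : G} {S T U : Finset G}

/-- CC2: `|Ω₁ ∪ Ω₂| ≤ |S||T||U|`. [folklore] -/
theorem card_C12_le (hTPP : TripleProductProperty S T U) (hzc : ∀ g : G, g * z = z * g) :
    ((Coll z S T U).filter C12).card ≤ (Pts S T U).card := by
  refine Finset.card_le_card_of_injOn (fun pp => (pp.2.1, pp.2.2.1, pp.1.2.2)) ?_ ?_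
  · intro pp hpp
    simp only [Finset.mem_coe, Finset.mem_filter, mem_Coll, mem_Pts] at hpp ⊢
    obtain ⟨⟨⟨h1, h2⟩, -⟩, -⟩ := hpp
    exact ⟨h2.1, h2.2.1, h1.2.2⟩
  · rintro ⟨⟨s₁, t₁, u₁⟩, ⟨s₁', t₁', u₁'⟩⟩ hpp ⟨⟨s₂, t₂, u₂⟩, ⟨s₂', t₂', u₂'⟩⟩ hqq heq
    simp only [Finset.mem_coe, Finset.mem_filter, mem_Coll, mem_Pts, wd, C12] at hpp hqq
    simp only [Prod.mk.injEq] at heq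
    obtain ⟨rfl, rfl, rfl⟩ := heq
    obtain ⟨⟨⟨⟨hs₁, ht₁, -⟩, ⟨-, -, hu₁'⟩⟩, h1⟩, hc1⟩ := hpp
    obtain ⟨⟨⟨⟨hs₂, ht₂, -⟩, ⟨-, -, hu₂'⟩⟩, h2⟩, hc2⟩ := hqq
    obtain ⟨rfl, rfl, rfl⟩ := inj12 hTPP hzc hs₁ hs₂ ht₁ ht₂ hu₁' hu₂' h1 h2 hc1 hc2
    rfl

/-- CC2: `|Ω₁ ∪ Ω₃| ≤ |S||T||U|`. [folklore] -/
theorem card_C13_le (hTPP : TripleProductProperty S T U) (hzc : ∀ g : G, g * z = z * g) :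
    ((Coll z S T U).filter C13).card ≤ (Pts S T U).card := by
  refine Finset.card_le_card_of_injOn (fun pp => (pp.2.1, pp.1.2.1, pp.2.2.2)) ?_ ?_
  · intro pp hpp
    simp only [Finset.mem_coe, Finset.mem_filter, mem_Coll, mem_Pts] at hpp ⊢
    obtain ⟨⟨⟨h1, h2⟩, -⟩, -⟩ := hpp
    exact ⟨h2.1, h1.2.1, h2.2.2⟩
  · rintro ⟨⟨s₁, t₁, u₁⟩, ⟨s₁', t₁', u₁'⟩⟩ hpp ⟨⟨s₂, t₂, u₂⟩, ⟨s₂', t₂', u₂'⟩⟩ hqq heq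
    simp only [Finset.mem_coe, Finset.mem_filter, mem_Coll, mem_Pts, wd, C13] at hpp hqq
    simp only [Prod.mk.injEq] at heq
    obtain ⟨rfl, rfl, rfl⟩ := heq
    obtain ⟨⟨⟨⟨hs₁, -, hu₁⟩, ⟨-, ht₁', -⟩⟩, h1⟩, hc1⟩ := hpp
    obtain ⟨⟨⟨⟨hs₂, -, hu₂⟩, ⟨-, ht₂', -⟩⟩, h2⟩, hc2⟩ := hqq
    obtain ⟨rfl, rfl, rfl⟩ := inj13 hTPP hzc hs₁ hs₂ ht₁' ht₂' hu₁ hu₂ h1 h2 hc1 hc2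
    rfl

/-- CC2: `|Ω₂ ∪ Ω₃| ≤ |S||T||U|`. [folklore] -/
theorem card_C23_le (hTPP : TripleProductProperty S T U) :
    ((Coll z S T U).filter C23).card ≤ (Pts S T U).card := by
  refine Finset.card_le_card_of_injOn (fun pp => (pp.1.1, pp.2.2.1, pp.2.2.2)) ?_ ?_
  · intro pp hpp
    simp only [Finset.mem_coe, Finset.mem_filter, mem_Coll, mem_Pts] at hpp ⊢
    obtain ⟨⟨⟨h1, h2⟩, -⟩, -⟩ := hpp
    exact ⟨h1.1, h2.2.1, h2.2.2⟩
  · rintro ⟨⟨s₁, t₁, u₁⟩, ⟨s₁', t₁', u₁'⟩⟩ hpp ⟨⟨s₂, t₂, u₂⟩, ⟨s₂', t₂', u₂'⟩⟩ hqq heq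
    simp only [Finset.mem_coe, Finset.mem_filter, mem_Coll, mem_Pts, wd, C23] at hpp hqq
    simp only [Prod.mk.injEq] at heq
    obtain ⟨rfl, rfl, rfl⟩ := heq
    obtain ⟨⟨⟨⟨-, ht₁, hu₁⟩, ⟨hs₁', -, -⟩⟩, h1⟩, hc1⟩ := hpp
    obtain ⟨⟨⟨⟨-, ht₂, hu₂⟩, ⟨hs₂', -, -⟩⟩, h2⟩, hc2⟩ := hqq
    obtain ⟨rfl, rfl, rfl⟩ := inj23 hTPP hs₁' hs₂' ht₁ ht₂ hu₁ hu₂ h1 h2 hc1 hc2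
    rfl

omit [Fintype G] in
/-- Lemma A on `Ω`: every collision lies in (at least) two of the three families. [folklore] -/
theorem coll_cover (hTPP : TripleProductProperty S T U)
    (hK4 : ∀ a b c : G, a * b * c = z → IsC a ∨ IsC b ∨ IsC c ∨ a * b * a⁻¹ * b⁻¹ = z)
    {pp : (G × G × G) × (G × G × G)} (hpp : pp ∈ Coll z S T U) :
    IsC (pp.1.1 * pp.2.1⁻¹) ∨ IsC (pp.1.2.1 * pp.2.2.1⁻¹) ∨ IsC (pp.1.2.2 * pp.2.2.2⁻¹) := by
  rw [mem_Coll, mem_Pts, mem_Pts] at hpp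
  obtain ⟨⟨⟨hs, ht, hu⟩, ⟨hs', ht', hu'⟩⟩, h⟩ := hpp
  exact central_quotient hTPP hK4 hs hs' ht ht' hu hu' h

/-- `2 |Ω| ≤ 3 |S||T||U|`. [folklore] -/
theorem two_card_Coll_le (hTPP : TripleProductProperty S T U) (hzc : ∀ g : G, g * z = z * g)
    (hK4 : ∀ a b c : G, a * b * c = z → IsC a ∨ IsC b ∨ IsC c ∨ a * b * a⁻¹ * b⁻¹ = z) :
    2 * (Coll z S T U).card ≤ 3 * (Pts S T U).card := by
  have h12 := card_C12_le (z := z) hTPP hzc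
  have h13 := card_C13_le (z := z) hTPP hzc
  have h23 := card_C23_le (z := z) hTPP
  simp only [Finset.card_filter] at h12 h13 h23
  have hpt : ∀ pp ∈ Coll z S T U,
      2 ≤ (if C12 pp then 1 else 0) + (if C13 pp then 1 else 0) + (if C23 pp then 1 else 0) := by
    intro pp hpp
    rcases coll_cover hTPP hK4 hpp with h | h | h <;>
      simp only [C12, C13, C23, h, true_or, or_true, if_true] <;> split_ifs <;> omega
  have hsum := Finset.sum_le_sum hpt
  simp only [Finset.sum_const, smul_eq_mul, Finset.sum_add_distrib] at hsum
  omega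

omit [Fintype G] [DecidableEq G] in
/-- two fibres `{stu, stu z}` meeting at `g` coincide. [folklore] -/
theorem rel_of_fib (hzz : z * z = 1) {p q : G × G × G} {g : G}
    (h1 : Fib z g p) (h2 : Fib z g q) : Rel z (p, q) := by
  unfold Fib at h1 h2; unfold Rel
  rcases h1 with h1 | h1 <;> rcases h2 with h2 | h2
  · exact Or.inl (h2.trans h1.symm)
  · right
    calc pr q = pr q * z * z := by rw [mul_assoc, hzz, mul_one]
      _ = pr p * z := by rw [h2, h1]
  · exact Or.inr (h2.trans h1.symm)
  · left; exact mul_right_cancel (h2.trans h1.symm)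

omit [Fintype G] in
/-- the `Rel`-pairs are diagonal or collisions: `#Rel ≤ |P| + |Ω|`. [folklore] -/
theorem card_Rel_le (hTPP : TripleProductProperty S T U) (hzc : ∀ g : G, g * z = z * g)
    (hzz : z * z = 1) (hcomm : ∀ g h : G, g * h * g⁻¹ * h⁻¹ = 1 ∨ g * h * g⁻¹ * h⁻¹ = z) :
    ((Pts S T U ×ˢ Pts S T U).filter (Rel z)).card ≤ (Pts S T U).card + (Coll z S T U).card := by
  have hsub : (Pts S T U ×ˢ Pts S T U).filter (Rel z)
      ⊆ (Pts S T U ×ˢ Pts S T U).filter (fun pp => pp.1 = pp.2) ∪ Coll z S T U := by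
    rintro ⟨⟨s, t, u⟩, ⟨s', t', u'⟩⟩ hpp
    rw [Finset.mem_filter, Finset.mem_product, mem_Pts, mem_Pts] at hpp
    obtain ⟨⟨⟨hs, ht, hu⟩, ⟨hs', ht', hu'⟩⟩, hrel⟩ := hpp
    simp only [Rel, pr] at hrel
    rw [Finset.mem_union, Finset.mem_filter, Finset.mem_product, mem_Coll, mem_Pts, mem_Pts]
    rcases M_word hzc hzz hcomm hrel with h1 | hz
    · left
      obtain ⟨rfl, rfl, rfl⟩ := hTPP s hs s' hs' t ht t' ht' u hu u' hu' h1
      exact ⟨⟨⟨hs, ht, hu⟩, ⟨hs, ht, hu⟩⟩, rfl⟩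
    · right
      exact ⟨⟨⟨hs, ht, hu⟩, ⟨hs', ht', hu'⟩⟩, hz⟩
  have hdiag : ((Pts S T U ×ˢ Pts S T U).filter (fun pp => pp.1 = pp.2)).card ≤ (Pts S T U).card := by
    refine Finset.card_le_card_of_injOn Prod.fst ?_ ?_
    · intro pp hpp
      simp only [Finset.mem_coe, Finset.mem_filter, Finset.mem_product] at hpp ⊢
      exact hpp.1.1
    · intro pp hpp qq hqq heq
      simp only [Finset.mem_coe, Finset.mem_filter] at hpp hqq
      exact Prod.ext heq (hpp.2.symm.trans (heq.trans hqq.2))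
  calc ((Pts S T U ×ˢ Pts S T U).filter (Rel z)).card
      ≤ ((Pts S T U ×ˢ Pts S T U).filter (fun pp => pp.1 = pp.2) ∪ Coll z S T U).card :=
        Finset.card_le_card hsub
    _ ≤ ((Pts S T U ×ˢ Pts S T U).filter (fun pp => pp.1 = pp.2)).card + (Coll z S T U).card :=
        Finset.card_union_le _ _
    _ ≤ (Pts S T U).card + (Coll z S T U).card := by omega

/-- `Σ_g b(g) = 2 |P|` for `b(g) = #{p : g ∈ {stu, stu z}}`. [folklore] -/
theorem sum_fib (hz1 : z ≠ 1) :
    ∑ g : G, ((Pts S T U).filter (Fib z g)).card = 2 * (Pts S T U).card := by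
  have inner : ∀ p : G × G × G, (Finset.univ.filter (fun g => Fib z g p)).card = 2 := by
    intro p
    have hne : pr p ≠ pr p * z := fun h => hz1 (mul_left_cancel (h.symm.trans (mul_one _).symm))
    have hset : Finset.univ.filter (fun g => Fib z g p) = {pr p, pr p * z} := by
      ext g
      simp only [Fib, Finset.mem_filter, Finset.mem_univ, true_and, Finset.mem_insert,
        Finset.mem_singleton]
      constructor
      · rintro (h | h)
        · exact Or.inl h.symm
        · exact Or.inr h.symm
      · rintro (h | h)
        · exact Or.inl h.symm
        · exact Or.inr h.symm
    rw [hset, Finset.card_pair hne]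
  simp only [Finset.card_filter] at inner ⊢
  rw [Finset.sum_comm]
  simp only [inner, Finset.sum_const, smul_eq_mul]
  ring

/-- `Σ_g b(g)² ≤ 2 · #Rel`. [folklore] -/
theorem sum_fib_sq (hzz : z * z = 1) :
    ∑ g : G, ((Pts S T U).filter (Fib z g)).card ^ 2
      ≤ 2 * ((Pts S T U ×ˢ Pts S T U).filter (Rel z)).card := by
  have step : ∀ g : G, ((Pts S T U).filter (Fib z g)).card ^ 2
      = ((Pts S T U ×ˢ Pts S T U).filter (Fib2 z g)).card := by
    intro g
    rw [sq, ← Finset.card_product]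
    congr 1
    ext ⟨p, q⟩
    simp only [Finset.mem_product, Finset.mem_filter, Fib2]
    tauto
  have inner : ∀ pp : (G × G × G) × (G × G × G),
      (Finset.univ.filter (fun g => Fib2 z g pp)).card ≤ 2 * (if Rel z pp then 1 else 0) := by
    intro pp
    by_cases hr : Rel z pp
    · rw [if_pos hr, mul_one]
      calc (Finset.univ.filter (fun g => Fib2 z g pp)).card
          ≤ ({pr pp.1, pr pp.1 * z} : Finset G).card := by
            apply Finset.card_le_card
            intro g hg
            simp only [Finset.mem_filter, Finset.mem_univ, true_and, Fib2, Fib] at hg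
            rw [Finset.mem_insert, Finset.mem_singleton]
            rcases hg.1 with h | h
            · exact Or.inl h.symm
            · exact Or.inr h.symm
        _ ≤ 2 := Finset.card_le_two
    · rw [if_neg hr, mul_zero, Nat.le_zero, Finset.card_eq_zero, Finset.filter_eq_empty_iff]
      intro g _ hg
      obtain ⟨p, q⟩ := pp
      exact hr (rel_of_fib hzz hg.1 hg.2)
  simp only [Finset.card_filter] at inner
  calc ∑ g : G, ((Pts S T U).filter (Fib z g)).card ^ 2
      = ∑ g : G, ((Pts S T U ×ˢ Pts S T U).filter (Fib2 z g)).card :=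
        Finset.sum_congr rfl (fun g _ => step g)
    _ = ∑ g : G, ∑ pp ∈ Pts S T U ×ˢ Pts S T U, (if Fib2 z g pp then 1 else 0) := by
        simp only [Finset.card_filter]
    _ = ∑ pp ∈ Pts S T U ×ˢ Pts S T U, ∑ g : G, (if Fib2 z g pp then 1 else 0) := Finset.sum_comm
    _ ≤ ∑ pp ∈ Pts S T U ×ˢ Pts S T U, 2 * (if Rel z pp then 1 else 0) :=
        Finset.sum_le_sum (fun pp _ => inner pp)
    _ = 2 * ((Pts S T U ×ˢ Pts S T U).filter (Rel z)).card := by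
        rw [Finset.card_filter, Finset.mul_sum]

/-- **Main theorem (K4 bound).**  `4 |S||T||U| ≤ 5 |G|` for every TPP triple of a group with a
central involution `z` such that `G' ⊆ {1,z}` and every factorisation `a b c = z` has a central factor
or `[a,b] = z` — in particular for every group with `[G : Z(G)] = 4`. [folklore] -/
theorem K4_bound (hzc : ∀ g : G, g * z = z * g) (hzz : z * z = 1) (hz1 : z ≠ 1)
    (hcomm : ∀ g h : G, g * h * g⁻¹ * h⁻¹ = 1 ∨ g * h * g⁻¹ * h⁻¹ = z)
    (hK4 : ∀ a b c : G, a * b * c = z → IsC a ∨ IsC b ∨ IsC c ∨ a * b * a⁻¹ * b⁻¹ = z)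
    (hTPP : TripleProductProperty S T U) :
    4 * (S.card * T.card * U.card) ≤ 5 * Fintype.card G := by
  have hB := two_card_Coll_le (z := z) hTPP hzc hK4
  have hC := card_Rel_le (z := z) hTPP hzc hzz hcomm
  have hD1 := sum_fib (S := S) (T := T) (U := U) hz1
  have hD2 := sum_fib_sq (S := S) (T := T) (U := U) hzz
  have hCS := sq_sum_le_card_mul_sum_sq (s := (Finset.univ : Finset G))
    (f := fun g => ((Pts S T U).filter (Fib z g)).card)
  rw [hD1, Finset.card_univ] at hCS
  rw [← card_Pts]
  set v := (Pts S T U).card with hv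
  set n := Fintype.card G with hn
  set c := (Coll z S T U).card
  set r := ((Pts S T U ×ˢ Pts S T U).filter (Rel z)).card
  set q := ∑ g : G, ((Pts S T U).filter (Fib z g)).card ^ 2
  have h1 := Nat.mul_le_mul_left n hD2
  have h2 := Nat.mul_le_mul_left n hC
  have h3 := Nat.mul_le_mul_left n hB
  have h4 : 4 * v * v ≤ 5 * n * v := by nlinarith [hCS, h1, h2, h3]
  rcases Nat.eq_zero_or_pos v with hv0 | hvpos
  · rw [hv0]; simp
  · exact Nat.le_of_mul_le_mul_right h4 hvpos

/-- Corollary: no TPP triple of sizes `a, b, c` with `4abc > 5|G|`. [folklore] -/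
theorem not_realizesTPP (hzc : ∀ g : G, g * z = z * g) (hzz : z * z = 1) (hz1 : z ≠ 1)
    (hcomm : ∀ g h : G, g * h * g⁻¹ * h⁻¹ = 1 ∨ g * h * g⁻¹ * h⁻¹ = z)
    (hK4 : ∀ a b c : G, a * b * c = z → IsC a ∨ IsC b ∨ IsC c ∨ a * b * a⁻¹ * b⁻¹ = z)
    {a b c : ℕ} (habc : 5 * Fintype.card G < 4 * (a * b * c)) : ¬ RealizesTPP G a b c := by
  rintro ⟨S, T, U, hS, hT, hU, hTPP⟩
  have h := K4_bound hzc hzz hz1 hcomm hK4 (S := S) (T := T) (U := U) hTPP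
  rw [hS, hT, hU] at h
  omega

/-- The frontier cell AG-184-3: a K4 group of order 184 has no TPP triple of sizes `(9, 8, 4)`
(`4·288 = 1152 > 920 = 5·184`), so `β(G) < 288`; with `D₃(G) = 276 < 288` the group cannot beat `Σ dᵢ³`. [folklore] -/
theorem no_tpp_9_8_4_of_order_184 (hG : Fintype.card G = 184)
    (hzc : ∀ g : G, g * z = z * g) (hzz : z * z = 1) (hz1 : z ≠ 1)
    (hcomm : ∀ g h : G, g * h * g⁻¹ * h⁻¹ = 1 ∨ g * h * g⁻¹ * h⁻¹ = z)
    (hK4 : ∀ a b c : G, a * b * c = z → IsC a ∨ IsC b ∨ IsC c ∨ a * b * a⁻¹ * b⁻¹ = z) :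
    ¬ RealizesTPP G 9 8 4 :=
  not_realizesTPP hzc hzz hz1 hcomm hK4 (by rw [hG]; norm_num)

end Count

/-! ### The hypotheses as a bundle; transfer to `Q × A` (`A` abelian); the groups `D8 × A`, `Q8 × A` -/

section Transfer

/-- The K4 hypotheses on `(G, z)`. [folklore] -/
structure K4Hyp (G : Type*) [Group G] (z : G) : Prop where
  zc : ∀ g : G, g * z = z * g
  zz : z * z = 1
  z1 : z ≠ 1
  comm : ∀ g h : G, g * h * g⁻¹ * h⁻¹ = 1 ∨ g * h * g⁻¹ * h⁻¹ = z
  k4 : ∀ a b c : G, a * b * c = z → IsC a ∨ IsC b ∨ IsC c ∨ a * b * a⁻¹ * b⁻¹ = z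

variable {Q A : Type*} [Group Q] [CommGroup A]

/-- An element `(q, a)` of `Q × A` (`A` abelian) is central iff `q` is central in `Q`. [folklore] -/
theorem isC_prod_iff {q : Q} {a : A} : IsC ((q, a) : Q × A) ↔ IsC q := by
  constructor
  · intro h x
    have := congrArg Prod.fst (h (x, 1))
    simpa using this
  · rintro h ⟨x1, x2⟩
    show ((x1, x2) * (q, a) : Q × A) = (q, a) * (x1, x2)
    rw [Prod.mk_mul_mk, Prod.mk_mul_mk, h x1, mul_comm x2 a]

/-- `K4Hyp` passes from `Q` to `Q × A` for every abelian `A` (with `z ↦ (z, 1)`). [folklore] -/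
theorem K4Hyp.prod {z : Q} (H : K4Hyp Q z) : K4Hyp (Q × A) ((z, 1) : Q × A) where
  zc := by
    rintro ⟨q, a⟩
    rw [Prod.mk_mul_mk, Prod.mk_mul_mk, H.zc q, mul_one, one_mul]
  zz := by
    rw [Prod.mk_mul_mk, H.zz, mul_one]; rfl
  z1 := fun h => H.z1 (by simpa using congrArg Prod.fst h)
  comm := by
    rintro ⟨g1, g2⟩ ⟨h1, h2⟩
    have hA : g2 * h2 * g2⁻¹ * h2⁻¹ = 1 := by
      rw [mul_comm g2 h2, mul_inv_cancel_right, mul_inv_cancel]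
    simp only [Prod.mk_mul_mk, Prod.inv_mk, Prod.mk_eq_one, Prod.mk.injEq]
    rcases H.comm g1 h1 with h | h
    · exact Or.inl ⟨h, hA⟩
    · exact Or.inr ⟨h, hA⟩
  k4 := by
    rintro ⟨a1, a2⟩ ⟨b1, b2⟩ ⟨c1, c2⟩ habc
    simp only [Prod.mk_mul_mk, Prod.mk.injEq] at habc
    rcases H.k4 a1 b1 c1 habc.1 with h | h | h | h
    · exact Or.inl (isC_prod_iff.mpr h)
    · exact Or.inr (Or.inl (isC_prod_iff.mpr h))
    · exact Or.inr (Or.inr (Or.inl (isC_prod_iff.mpr h)))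
    · right; right; right
      simp only [Prod.mk_mul_mk, Prod.inv_mk, Prod.mk.injEq]
      exact ⟨h, by rw [mul_comm a2 b2, mul_inv_cancel_right, mul_inv_cancel]⟩

/-- `K4Hyp` gives the bound `4 abc ≤ 5 |G|` for realizable `⟨a, b, c⟩`. [folklore] -/
theorem K4Hyp.not_realizesTPP {G : Type*} [Group G] [Fintype G] [DecidableEq G] {z : G}
    (H : K4Hyp G z) {a b c : ℕ} (habc : 5 * Fintype.card G < 4 * (a * b * c)) :
    ¬ RealizesTPP G a b c :=
  Summit.MatrixMultiplication.OmegaCensus.K4Bound.not_realizesTPP H.zc H.zz H.z1 H.comm H.k4 habc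

/-- `D8` (as `DihedralGroup 4`, central involution `r 2`) satisfies the K4 hypotheses. [folklore] -/
theorem K4Hyp_D8 : K4Hyp (DihedralGroup 4) (DihedralGroup.r 2) where
  zc := by decide
  zz := by decide
  z1 := by decide
  comm := by decide
  k4 := by decide

/-- `Q8` (as `QuaternionGroup 2`, central involution `a 2`) satisfies the K4 hypotheses. [folklore] -/
theorem K4Hyp_Q8 : K4Hyp (QuaternionGroup 2) (QuaternionGroup.a 2) where
  zc := by decide
  zz := by decide
  z1 := by decide
  comm := by decide
  k4 := by decide

/-- **`β(D8 × A) ≤ (5/4)·|D8 × A|`**: no TPP triple `⟨a,b,c⟩` in `D8 × A` (`A` finite abelian) with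
`4abc > 5 · 8|A|`. [folklore] -/
theorem D8_prod_not_realizesTPP [Fintype A] [DecidableEq A] {a b c : ℕ}
    (habc : 5 * (8 * Fintype.card A) < 4 * (a * b * c)) :
    ¬ RealizesTPP (DihedralGroup 4 × A) a b c := by
  refine (K4Hyp_D8.prod (A := A)).not_realizesTPP ?_
  rw [Fintype.card_prod, DihedralGroup.card]
  simpa using habc

/-- **`β(Q8 × A) ≤ (5/4)·|Q8 × A|`**. [folklore] -/
theorem Q8_prod_not_realizesTPP [Fintype A] [DecidableEq A] {a b c : ℕ}
    (habc : 5 * (8 * Fintype.card A) < 4 * (a * b * c)) :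
    ¬ RealizesTPP (QuaternionGroup 2 × A) a b c := by
  refine (K4Hyp_Q8.prod (A := A)).not_realizesTPP ?_
  rw [Fintype.card_prod, QuaternionGroup.card]
  simpa using habc

/-- Frontier cell AG-184-3 (order 184 = 8·23, the K4 groups `D8 × C23`, `Q8 × C23`, `D₃ = 276`):
no TPP triple of sizes `(9, 8, 4)` (volume 288), kernel-checked. [folklore] -/
theorem D8xC23_no_tpp_9_8_4 : ¬ RealizesTPP (DihedralGroup 4 × Multiplicative (ZMod 23)) 9 8 4 :=
  D8_prod_not_realizesTPP (by simp)

/-- Frontier cell AG-184-3, the group `Q8 × C23`: no TPP triple of sizes `(9, 8, 4)`. [folklore] -/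
theorem Q8xC23_no_tpp_9_8_4 : ¬ RealizesTPP (QuaternionGroup 2 × Multiplicative (ZMod 23)) 9 8 4 :=
  Q8_prod_not_realizesTPP (by simp)

end Transfer

end Summit.MatrixMultiplication.OmegaCensus.K4Bound
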